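import Summits.QuantumFields.YangMills.Theorems.BalabanUVNodesN15KingModelAnalyticDeterminantRealSlice
import Literature.LinearAlgebra.Matrix.SpectralNormVsMatrixNorms
import HarnessLib

/-!
# BalabanUVNodes ∕ N15 — THE KING-MODEL RUNG (PART Ϭ-c): KING's EFFECTIVE LAPLACIAN IN OPERATOR NORM — `‖Δ_eff(U)‖ ≤ a` and `‖Δ_eff(U) − Δ_eff(V)‖ ≤ a²∕(a+m²)` at EVERY pair of
# unitary backgrounds (spectral norm = largest |eigenvalue|, [HornJohnson2013] Thm 5.6.9 ∕ 5.6.P56, on PART Ϫ-l's spectrum `[am²∕(a+m²), a]`); in the complex window the operator-norm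
# Lipschitz bound `‖Δ_eff(U,U⁻¹) − Δ_eff(U₀)‖ ≤ Γ₁·covLip·(Lε∕s₀)·a` (resolvent identity through NE2's unit layer) and the ACCRETIVITY CONSTANT STARTING FROM THE SHARP FLOOR
# `am²∕(a+m²) − Γ₁·covLip·(Lε∕s₀)·a ≤ Re Δ_eff(U,U⁻¹)`, with the matching determinant floor — doors (t7⁵⁸)∕(t8⁵⁸) of §g52 closed
# (Track A, DAG node N15 = NE2; FAN-OUT v1.1 §N15 s3 «KING-MODEL RUNG … + what the curved case adds»; count-neutral)

HONEST FRAMING.  Count-neutral (cell `pub-ymgap`, seat `pub-ymgap-dag-n15-e` g53; `--supports stmt-QuantumFields-27247 --as helper` = K3ᴬ, KEY MAP v3).  King's one-level comparison model;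
`a, m² > 0`; §1 at every unitary background over any `RCLike` fibre field; §2 in PART Ϫ-b's complex window at `𝕜 = ℂ` with PART Ϫ-f∕Ϫ-g's crude constants (`covLip`, `Γ₁ = (a + a²(8∕m²)e³)K_{d+1}`);
the improvement over Ϫ-f is the LEADING constant (`am²∕(a+m²)`, sharp at `ε = 0` by Ϫ-j) — the defect term is not optimised.  NOT Bałaban's multi-level objects; NOT a node discharge (N15 of record
untouched); nothing continuum ∕ ℝ⁴ ∕ OS ∕ Clay.

THE RESULTS:
* §1 (unitary `U, V`; `a, m² > 0`, `c ≥ 0`) ★★★ **`l2_opNorm_effLapU_le_coupling`** (`‖Δ_eff(U)‖ ≤ a` — door t7⁵⁸), `isHermitian_effLapU_sub_center`, ★★ `eigenvalue_effLapU_sub_center_abs_le`,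
  ★★★ **`l2_opNorm_effLapU_sub_center_le`** (`‖Δ_eff(U) − ½(a+β♯)·1‖ ≤ ½(a−β♯)`, `β♯ = (a⁻¹+m⁻²)⁻¹`), ★★★ **`l2_opNorm_effLapU_sub_le_uniform`** (`‖Δ_eff(U) − Δ_eff(V)‖ ≤ a − β♯ = a²∕(a+m²)`
  for ANY two backgrounds — η-uniform, no window; PART Ϧ-l's `O(Lε)` Lipschitz bound is the better one for close fields), `coupling_sub_floor_eq`.
* §2 (`𝕜 = ℂ`, complex `U` with `‖U_b − U₀_b‖ ≤ ε`, `0 < ε`, `2Lε ≤ s₀(m²,a,d)`, King's scaling `c = L²`, comb depth): ★★★ **`l2_opNorm_cxEffLap_sub_effLapU_le`**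
  (`‖Δ_eff(U,U⁻¹) − Δ_eff(U₀)‖ ≤ Γ₁·(covLip·Lε∕s₀(m²,0,d))·a` via `Δ_U − Δ₀ = Δ_U(C₀ − C_U)Δ₀`), ★★★★ **`re_quadForm_cxEffLap_ge_sharp`** (`(β♯ − Γ₁·covLip·(Lε∕s₀)·a)‖g‖² ≤ Re⟨g,Δ_eff(U,U⁻¹)g⟩` —
  door t8⁵⁸: the accretivity constant starts from Ϫ-l's SHARP floor instead of Ϫ-f's `β₁`), ★★ `re_eigenvalue_cxEffLap_ge_sharp`, ★★★ **`pow_le_norm_det_cxEffLap_sharp`**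
  (`(β♯ − Γ₁·covLip·(Lε∕s₀)·a)^{N} ≤ |det Δ_eff(U,U⁻¹)|` whenever the constant is `≥ 0`).
PRIOR TREE ART (by name): Ϫ-l (`isHermitian_effLapU`, `eigenvalues_effLapU_mem_Icc`, `eigenvalue_effLapU_pos_and_inv_le`, `king_effLap_real_slice_sandwich`, `inv_effLapU_mul_effLapU`), Ϫ-b
(`cxEffLap_mul_cxBlockCov_at_massRadius`), Ϫ-a (`cxBlockCov_inv_of_unitary`), Ϫ-f (`covLip`, `l2_opNorm_cxBlockCov_sub_le_eta_uniform`, `windows_of_h2a`, `re_quadForm_ge_neg_l2_opNorm`,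
`re_eigenvalue_ge_of_quadForm`), Ϫ-g (`l2_opNorm_cxEffLap_at_massRadius_le`, `pow_card_le_norm_det_of_eigen`), Literature `SpectralNormVsMatrixNorms.l2_opNorm_eq_norm_eigenvalues` ([HJ] 5.6.9 (a)),
`RayleighQuotient` (`mulVec_eigenvectorBasis_eq_coe_smul`, `sum_norm_sq_eigenvectorBasis`), Mathlib (`pi_norm_le_iff_of_nonneg`, `Matrix.l2_opNorm_mul`).  Dedup (rg at filing): basename 0 files; needles
`l2_opNorm_effLapU_le_coupling|l2_opNorm_effLapU_sub_le_uniform|l2_opNorm_cxEffLap_sub_effLapU_le|re_quadForm_cxEffLap_ge_sharp|pow_le_norm_det_cxEffLap_sharp` 0 tree files.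
Locators: [King1986] (2.14) p.653, (4.33)–(4.34) p.674, (4.44) p.675; [Balaban1985BackgroundPropagators] (3.25) p.394, Thm 3.4 p.400; [HornJohnson2013] Thm 5.6.9 (a) and 5.6.P56 (§5.6 «Matrix norms», print pp.340–370; held text chunks p0438 ∕ p0465), Thm 4.2.2 (c) p.234.
0 `sorry`, 0 `def`.  v1.1 (DOC-ONLY, ERRATUM-Ϭ1): v1.0 printed guessed print pages «p.347»∕«p.370» for [HJ] Thm 5.6.9 ∕ 5.6.P56; the held text carries no print
pagination — corrected to the section locator (§5.6, print pp.340–370 by the table of contents) and the held chunks p0438 ∕ p0465 (as in the tree's `SpectralNormVsMatrixNorms`); declarations byte-identical.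
-/

noncomputable section
open scoped BigOperators ComplexConjugate ComplexOrder Matrix.Norms.L2Operator
open Finset Matrix WithLp

namespace Summit.QuantumFields.YangMills.BalabanUVNodes.N15KingModelRung.Analytic

open Literature.MathematicalPhysics.QuantumFieldTheory.Balaban1983to89 (B4Sect5Proof.latticeConst B4Sect5Proof.latticeConst_nonneg)
open Literature.MathematicalPhysics.QuantumFieldTheory.Balaban1983to89.B5Prop11Plancherel (Tor fine)
open Literature.LinearAlgebra.Matrix.SpectralNormVsMatrixNorms (l2_opNorm_eq_norm_eigenvalues)
open Literature.LinearAlgebra.Matrix.RayleighQuotient (mulVec_eigenvectorBasis_eq_coe_smul sum_norm_sq_eigenvectorBasis)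
open Summit.QuantumFields.YangMills.BalabanUVNodes.N15KingModelRung.CovariantBlock (BlockTree effLapU)
open Summit.QuantumFields.YangMills.BalabanUVNodes.N15KingModelRung.CombesThomas (ctRate)

variable {d : ℕ} {L : ℕ} [NeZero L] (T : BlockTree d L) (M : Fin (d + 1) → ℕ) [hM : ∀ μ, NeZero (M μ)]
variable {n : Type*} [Fintype n] [DecidableEq n]

/-! ## §1 The real slice in operator norm -/

section RealSlice

variable {𝕜 : Type*} [RCLike 𝕜]
variable {a c m2 : ℝ} (ha : 0 < a) (hc : 0 ≤ c) (hm : 0 < m2) {U : Tor (fine L M) × Fin (d + 1) → Matrix n n 𝕜} (hU : ∀ bd, U bd ∈ Matrix.unitaryGroup n 𝕜)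
include ha hc hm hU

/-- ★★★ **`‖Δ_eff(U)‖ ≤ a` AT EVERY UNITARY BACKGROUND** (door t7⁵⁸): the spectral norm of the Hermitian `Δ_eff(U)` is its largest |eigenvalue| ([HJ] Thm 5.6.9 (a)), and PART Ϫ-l puts every eigenvalue
in `[am²∕(a+m²), a]`. [cite: King1986, (2.14) p.653, (4.33) p.674; HornJohnson2013, Thm 5.6.9 (a) §5.6 (held chunk p0438), Thm 4.2.2 (c) p.234] -/
theorem l2_opNorm_effLapU_le_coupling : ‖effLapU T M a c m2 U‖ ≤ a := by
  have hH := isHermitian_effLapU T M ha hc hm hU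
  rw [l2_opNorm_eq_norm_eigenvalues hH, pi_norm_le_iff_of_nonneg ha.le]
  intro p
  obtain ⟨h1, h2⟩ := eigenvalues_effLapU_mem_Icc T M ha hc hm hU p
  have h0 : 0 ≤ hH.eigenvalues p := le_trans (by positivity) h1
  rw [Function.comp_apply, RCLike.norm_ofReal, abs_of_nonneg h0]
  exact h2

/-- `Δ_eff(U) − t·1` is Hermitian for real `t`. [cite: King1986, (2.14) p.653] -/
theorem isHermitian_effLapU_sub_center (t : ℝ) : (effLapU T M a c m2 U - ((t : ℝ) : 𝕜) • (1 : Matrix (Tor M × n) (Tor M × n) 𝕜)).IsHermitian := by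
  refine (isHermitian_effLapU T M ha hc hm hU).sub ?_
  rw [Matrix.IsHermitian, Matrix.conjTranspose_smul, Matrix.conjTranspose_one, RCLike.star_def, RCLike.conj_ofReal]

/-- ★★ **THE CENTRED SPECTRUM**: every eigenvalue `μ` of `Δ_eff(U) − ½(a+β♯)·1` has `|μ| ≤ ½(a−β♯)`, `β♯ = (a⁻¹+m⁻²)⁻¹` (an eigenvector of the centred operator is an eigenvector of `Δ_eff(U)`
with eigenvalue `μ + ½(a+β♯) ∈ [β♯, a]`, PART Ϫ-l). [cite: King1986, (2.14) p.653, (4.33) p.674; HornJohnson2013, Thm 4.2.2 (c) p.234] -/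
theorem eigenvalue_effLapU_sub_center_abs_le (p : Tor M × n) :
    |(isHermitian_effLapU_sub_center T M ha hc hm hU ((a + (a⁻¹ + m2⁻¹)⁻¹) / 2)).eigenvalues p| ≤ (a - (a⁻¹ + m2⁻¹)⁻¹) / 2 := by
  set t : ℝ := (a + (a⁻¹ + m2⁻¹)⁻¹) / 2 with ht
  set hH := isHermitian_effLapU_sub_center T M ha hc hm hU t
  set μ := hH.eigenvalues p with hμ
  have hv0 : (⇑(hH.eigenvectorBasis p) : Tor M × n → 𝕜) ≠ 0 := by
    intro h0
    have h1 := sum_norm_sq_eigenvectorBasis hH p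
    rw [h0] at h1
    simp at h1
  have hev := mulVec_eigenvectorBasis_eq_coe_smul hH p
  -- `Δ_eff v = (μ + t) v`
  have hΔv : effLapU T M a c m2 U *ᵥ (⇑(hH.eigenvectorBasis p) : Tor M × n → 𝕜) = (((μ + t : ℝ)) : 𝕜) • (⇑(hH.eigenvectorBasis p) : Tor M × n → 𝕜) := by
    have h := hev
    rw [Matrix.sub_mulVec, Matrix.smul_mulVec, Matrix.one_mulVec, sub_eq_iff_eq_add] at h
    rw [h, ← add_smul, ← RCLike.ofReal_add]
  obtain ⟨hpos, h1, h2⟩ := eigenvalue_effLapU_pos_and_inv_le T M ha hc hm hU hv0 hΔv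
  have hup : μ + t ≤ a := by
    have := (inv_le_inv₀ ha hpos).mp h1
    exact this
  have hlo : (a⁻¹ + m2⁻¹)⁻¹ ≤ μ + t := (inv_le_comm₀ (by positivity) hpos).mpr h2
  rw [abs_le]
  constructor <;> linarith

/-- ★★★ **`‖Δ_eff(U) − ½(a+β♯)·1‖ ≤ ½(a−β♯)`** at every unitary background. [cite: King1986, (2.14) p.653, (4.33) p.674; HornJohnson2013, Thm 5.6.9 (a) §5.6 (held chunk p0438)] -/
theorem l2_opNorm_effLapU_sub_center_le :
    ‖effLapU T M a c m2 U - ((((a + (a⁻¹ + m2⁻¹)⁻¹) / 2 : ℝ)) : 𝕜) • (1 : Matrix (Tor M × n) (Tor M × n) 𝕜)‖ ≤ (a - (a⁻¹ + m2⁻¹)⁻¹) / 2 := by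
  have hH := isHermitian_effLapU_sub_center T M ha hc hm hU ((a + (a⁻¹ + m2⁻¹)⁻¹) / 2)
  have hr : 0 ≤ (a - (a⁻¹ + m2⁻¹)⁻¹) / 2 := by
    have : (a⁻¹ + m2⁻¹)⁻¹ ≤ a := by
      rw [inv_le_comm₀ (by positivity) ha]
      exact le_add_of_nonneg_right (by positivity)
    linarith
  rw [l2_opNorm_eq_norm_eigenvalues hH, pi_norm_le_iff_of_nonneg hr]
  intro p
  rw [Function.comp_apply, RCLike.norm_ofReal]
  exact eigenvalue_effLapU_sub_center_abs_le T M ha hc hm hU p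

omit hc hm hU in
/-- `a − β♯ = a²∕(a+m²)`. [cite: King1986, (4.33) p.674] -/
theorem coupling_sub_floor_eq (hm : 0 < m2) : a - (a⁻¹ + m2⁻¹)⁻¹ = a ^ 2 / (a + m2) := by
  have hm2 : a + m2 ≠ 0 := by positivity
  have h1 : a⁻¹ + m2⁻¹ = (a + m2) / (a * m2) := by field_simp; ring
  rw [h1, inv_div]
  field_simp
  ring

omit hU in
/-- ★★★ **ANY TWO BACKGROUNDS**: `‖Δ_eff(U) − Δ_eff(V)‖ ≤ a − β♯ = a²∕(a+m²)` for all unitary `U, V` — both operators lie within `½(a−β♯)` of the same multiple of the identity; η-uniform, no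
window, no curvature hypothesis (PART Ϧ-l's `O(Lε)` bound is the better one for close fields). [cite: King1986, (2.14) p.653, (4.33) p.674; HornJohnson2013, Thm 5.6.9 (a) §5.6 (held chunk p0438)] -/
theorem l2_opNorm_effLapU_sub_le_uniform {U V : Tor (fine L M) × Fin (d + 1) → Matrix n n 𝕜} (hU : ∀ bd, U bd ∈ Matrix.unitaryGroup n 𝕜) (hV : ∀ bd, V bd ∈ Matrix.unitaryGroup n 𝕜) :
    ‖effLapU T M a c m2 U - effLapU T M a c m2 V‖ ≤ a - (a⁻¹ + m2⁻¹)⁻¹ := by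
  set Z : Matrix (Tor M × n) (Tor M × n) 𝕜 := ((((a + (a⁻¹ + m2⁻¹)⁻¹) / 2 : ℝ)) : 𝕜) • 1 with hZ
  have h1 := l2_opNorm_effLapU_sub_center_le T M ha hc hm hU
  have h2 := l2_opNorm_effLapU_sub_center_le T M ha hc hm hV
  have e : effLapU T M a c m2 U - effLapU T M a c m2 V = (effLapU T M a c m2 U - Z) - (effLapU T M a c m2 V - Z) := by rw [hZ]; abel
  rw [e]
  calc ‖(effLapU T M a c m2 U - Z) - (effLapU T M a c m2 V - Z)‖ ≤ ‖effLapU T M a c m2 U - Z‖ + ‖effLapU T M a c m2 V - Z‖ := norm_sub_le _ _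
    _ ≤ (a - (a⁻¹ + m2⁻¹)⁻¹) / 2 + (a - (a⁻¹ + m2⁻¹)⁻¹) / 2 := add_le_add h1 h2
    _ = a - (a⁻¹ + m2⁻¹)⁻¹ := by ring

end RealSlice

/-! ## §2 The complex window: operator-norm Lipschitz of `Δ_eff` and the accretivity constant from the sharp floor -/

section Window

variable (hD : ∀ j, T.depth j ≤ (d + 1) * (L - 1)) {a m2 : ℝ} (ha : 0 < a) (hm : 0 < m2) (hL : 1 ≤ L)
variable {U₀ U : Tor (fine L M) × Fin (d + 1) → Matrix n n ℂ} (hU₀ : ∀ bd, U₀ bd ∈ Matrix.unitaryGroup n ℂ)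
variable {ε : ℝ} (hε : 0 < ε) (hU : ∀ bd, ‖U bd - U₀ bd‖ ≤ ε) (h2a : 2 * ((L : ℝ) * ε) ≤ sliceRadius m2 a d)
include hD ha hm hL hU₀ hε hU h2a

/-- ★★★ **`Δ_eff` IS LIPSCHITZ IN THE BACKGROUND IN OPERATOR NORM THROUGH NE2's UNIT LAYER**: `‖Δ_eff(U,U⁻¹) − Δ_eff(U₀)‖ ≤ Γ₁·(covLip·Lε∕s₀(m²,0,d))·a`, by the resolvent identity
`Δ_U − Δ₀ = Δ_U·(C₀ − C_U)·Δ₀` with PART Ϫ-g's `‖Δ_U‖ ≤ Γ₁`, PART Ϫ-f's `‖C_U − C₀‖ ≤ covLip·Lε∕s₀` and §1's `‖Δ₀‖ ≤ a`.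
[cite: King1986, (2.14) p.653, (4.34) p.674, Lemma 4.5 (4.38) p.674, (4.44) p.675; Balaban1985BackgroundPropagators, Thm 3.4 p.400] -/
theorem l2_opNorm_cxEffLap_sub_effLapU_le :
    ‖cxEffLap T M a ((L : ℝ) ^ 2) m2 U (fun bd => (U bd)⁻¹) - effLapU T M a ((L : ℝ) ^ 2) m2 U₀‖
      ≤ (a + a ^ 2 * (8 / m2 * Real.exp 3)) * B4Sect5Proof.latticeConst (d + 1) (ctRate (m2 / 2) a d) * (covLip m2 d * ((L : ℝ) * ε / sliceRadius m2 0 d)) * a := by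
  obtain ⟨h2, hrad⟩ := windows_of_h2a (L := L) ha hm hε h2a
  set ΔU := cxEffLap T M a ((L : ℝ) ^ 2) m2 U (fun bd => (U bd)⁻¹) with hΔU
  set CU := cxBlockCov T M a ((L : ℝ) ^ 2) m2 U (fun bd => (U bd)⁻¹) with hCU
  set Δ0 := effLapU T M a ((L : ℝ) ^ 2) m2 U₀ with hΔ0
  set C0 := cxBlockCov T M a ((L : ℝ) ^ 2) m2 U₀ (fun bd => (U₀ bd)⁻¹) with hC0
  have hc : (0 : ℝ) ≤ (L : ℝ) ^ 2 := by positivity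
  have hΔC : ΔU * CU = 1 := cxEffLap_mul_cxBlockCov_at_massRadius T M hD ha hm hL hU₀ hε.le hU hrad
  have hC0Δ : C0 * Δ0 = 1 := by rw [hC0, cxBlockCov_inv_of_unitary T M ha hc hm hU₀, hΔ0, inv_effLapU_mul_effLapU T M ha hc hm hU₀]
  have e : ΔU - Δ0 = ΔU * (C0 - CU) * Δ0 := by
    rw [Matrix.mul_sub, Matrix.sub_mul, Matrix.mul_assoc ΔU C0, hC0Δ, Matrix.mul_one, hΔC, Matrix.one_mul]
  have hΔUn : ‖ΔU‖ ≤ (a + a ^ 2 * (8 / m2 * Real.exp 3)) * B4Sect5Proof.latticeConst (d + 1) (ctRate (m2 / 2) a d) :=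
    l2_opNorm_cxEffLap_at_massRadius_le T M hD ha hm hL hU₀ hε.le hU hrad
  have hCn : ‖C0 - CU‖ ≤ covLip m2 d * ((L : ℝ) * ε / sliceRadius m2 0 d) := by
    rw [norm_sub_rev]; exact l2_opNorm_cxBlockCov_sub_le_eta_uniform T M hD hm hL hU₀ hε hU h2
  have hΔ0n : ‖Δ0‖ ≤ a := l2_opNorm_effLapU_le_coupling T M ha hc hm hU₀
  have hΓ0 : 0 ≤ (a + a ^ 2 * (8 / m2 * Real.exp 3)) * B4Sect5Proof.latticeConst (d + 1) (ctRate (m2 / 2) a d) := le_trans (norm_nonneg _) hΔUn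
  have hcov0 : 0 ≤ covLip m2 d * ((L : ℝ) * ε / sliceRadius m2 0 d) := le_trans (norm_nonneg _) hCn
  rw [e]
  calc ‖ΔU * (C0 - CU) * Δ0‖ ≤ ‖ΔU * (C0 - CU)‖ * ‖Δ0‖ := Matrix.l2_opNorm_mul _ _
    _ ≤ (‖ΔU‖ * ‖C0 - CU‖) * ‖Δ0‖ := mul_le_mul_of_nonneg_right (Matrix.l2_opNorm_mul _ _) (norm_nonneg _)
    _ ≤ ((a + a ^ 2 * (8 / m2 * Real.exp 3)) * B4Sect5Proof.latticeConst (d + 1) (ctRate (m2 / 2) a d) * (covLip m2 d * ((L : ℝ) * ε / sliceRadius m2 0 d))) * a := by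
        gcongr

/-- ★★★★ **THE ACCRETIVITY CONSTANT STARTS FROM THE SHARP FLOOR** (door t8⁵⁸): in the window,
`((a⁻¹+m⁻²)⁻¹ − Γ₁·(covLip·Lε∕s₀(m²,0,d))·a)·‖g‖² ≤ Re⟨g, Δ_eff(U,U⁻¹)g⟩` for every block field `g` — PART Ϫ-l's `am²∕(a+m²)` at the unitary centre minus the operator-norm Lipschitz defect.
[cite: King1986, (2.14) p.653, (4.33) p.674, (4.44) p.675; Balaban1985BackgroundPropagators, (3.25) p.394, Thm 3.4 p.400] -/
theorem re_quadForm_cxEffLap_ge_sharp [Nonempty n] (g : Tor M × n → ℂ) :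
    ((a⁻¹ + m2⁻¹)⁻¹ - (a + a ^ 2 * (8 / m2 * Real.exp 3)) * B4Sect5Proof.latticeConst (d + 1) (ctRate (m2 / 2) a d) * (covLip m2 d * ((L : ℝ) * ε / sliceRadius m2 0 d)) * a)
        * ‖(toLp 2 g : EuclideanSpace ℂ (Tor M × n))‖ ^ 2
      ≤ RCLike.re (star g ⬝ᵥ (cxEffLap T M a ((L : ℝ) ^ 2) m2 U (fun bd => (U bd)⁻¹) *ᵥ g)) := by
  have hc : (0 : ℝ) ≤ (L : ℝ) ^ 2 := by positivity
  set ΔU := cxEffLap T M a ((L : ℝ) ^ 2) m2 U (fun bd => (U bd)⁻¹) with hΔU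
  set Δ0 := effLapU T M a ((L : ℝ) ^ 2) m2 U₀ with hΔ0
  have hsplit : star g ⬝ᵥ (ΔU *ᵥ g) = star g ⬝ᵥ (Δ0 *ᵥ g) + star g ⬝ᵥ ((ΔU - Δ0) *ᵥ g) := by
    rw [Matrix.sub_mulVec, dotProduct_sub]; ring
  have h0 := (king_effLap_real_slice_sandwich T M ha hc hm hU₀ g).1
  have h1 := re_quadForm_ge_neg_l2_opNorm M (ΔU - Δ0) g
  have h2 := l2_opNorm_cxEffLap_sub_effLapU_le T M hD ha hm hL hU₀ hε hU h2a
  have hg0 : 0 ≤ ‖(toLp 2 g : EuclideanSpace ℂ (Tor M × n))‖ ^ 2 := sq_nonneg _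
  rw [hsplit, map_add]
  nlinarith [mul_le_mul_of_nonneg_right h2 hg0]

/-- ★★ **EVERY EIGENVALUE OF `Δ_eff(U,U⁻¹)` HAS `Re μ ≥ (a⁻¹+m⁻²)⁻¹ − Γ₁·covLip·(Lε∕s₀)·a`** in the window. [cite: King1986, (2.14) p.653, (4.33) p.674; Balaban1985BackgroundPropagators, Thm 3.4 p.400] -/
theorem re_eigenvalue_cxEffLap_ge_sharp [Nonempty n] {μ : ℂ} {v : Tor M × n → ℂ} (hv : v ≠ 0) (hΔv : cxEffLap T M a ((L : ℝ) ^ 2) m2 U (fun bd => (U bd)⁻¹) *ᵥ v = μ • v) :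
    (a⁻¹ + m2⁻¹)⁻¹ - (a + a ^ 2 * (8 / m2 * Real.exp 3)) * B4Sect5Proof.latticeConst (d + 1) (ctRate (m2 / 2) a d) * (covLip m2 d * ((L : ℝ) * ε / sliceRadius m2 0 d)) * a ≤ μ.re :=
  re_eigenvalue_ge_of_quadForm M (re_quadForm_cxEffLap_ge_sharp T M hD ha hm hL hU₀ hε hU h2a) hv hΔv

/-- ★★★ **THE DETERMINANT FLOOR FROM THE SHARP CONSTANT**: whenever `0 ≤ β♯ − Γ₁·covLip·(Lε∕s₀)·a`, `(β♯ − Γ₁·covLip·(Lε∕s₀)·a)^{N} ≤ |det Δ_eff(U,U⁻¹)|` — the block-field Gaussian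
normalisation in the window is controlled by the constant that is EXACT at the unitary centre. [cite: King1986, (2.14) p.653, (3.89) p.668, (4.33) p.674; Balaban1985BackgroundPropagators, Thm 3.4 p.400] -/
theorem pow_le_norm_det_cxEffLap_sharp [Nonempty n]
    (hβ : 0 ≤ (a⁻¹ + m2⁻¹)⁻¹ - (a + a ^ 2 * (8 / m2 * Real.exp 3)) * B4Sect5Proof.latticeConst (d + 1) (ctRate (m2 / 2) a d) * (covLip m2 d * ((L : ℝ) * ε / sliceRadius m2 0 d)) * a) :
    ((a⁻¹ + m2⁻¹)⁻¹ - (a + a ^ 2 * (8 / m2 * Real.exp 3)) * B4Sect5Proof.latticeConst (d + 1) (ctRate (m2 / 2) a d) * (covLip m2 d * ((L : ℝ) * ε / sliceRadius m2 0 d)) * a)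
        ^ Fintype.card (Tor M × n)
      ≤ ‖(cxEffLap T M a ((L : ℝ) ^ 2) m2 U (fun bd => (U bd)⁻¹)).det‖ :=
  pow_card_le_norm_det_of_eigen hβ fun μ _ hv hΔv =>
    (re_eigenvalue_cxEffLap_ge_sharp T M hD ha hm hL hU₀ hε hU h2a hv hΔv).trans (Complex.re_le_norm μ)

end Window

end Summit.QuantumFields.YangMills.BalabanUVNodes.N15KingModelRung.Analytic

end
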